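import Summits.CriticalPhenomena.PercolationContinuityZ3.Theorems.PercAnnulusCrossingIICTwoPointUpper
import Summits.CriticalPhenomena.PercolationContinuityZ3.Theorems.PercAnnulusCrossingIICPlanarColumn
import Summits.CriticalPhenomena.PercolationContinuityZ3.Theorems.PercNearOneGluingNoHeavyOneArmClusterDecoupling
import HarnessLib

/-!
# The IIC is dominated on `Λ(b)` by the arm-conditioned measure: `ν(E) ≤ P_p(E ∩ {0 ↔ ∂ⁱⁿΛ(b)}) / (c·π_p(b+1))` (lane RSW3, p1 gen 7)

builds on p205010 (kernel theorem, internal audit signed; external expert review pending) — used only by the `p_c(ℤ^d)` statement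
(through the (A2)□ ⇒ one-arm quasi-multiplicativity bridge); the general-`p` statements and the `ℤ²` statement do not use it.

Seat `prim-rsw3-p1` (gen 7).  A one-sided Radon–Nikodym bound for Kesten's IIC measure `ν` on the `σ`-field of a box: for every event
`E` determined by the pairs of `Λ(b)`, the one-arm event `A_N = {0 ↔ ∂ⁱⁿΛ(N)}` (`N > b+1`) forces `A_b` and, after the arm's last visit to
`Λ(b)`, a crossing `T(b,N)` of `Λ(N) ∖ Λ(b)` from `∂ⁱⁿΛ(b+1)` which uses no pair of `Λ(b)`; so `P_p(E ∩ A_N) ≤ P_p(E ∩ A_b)·P_p(T(b,N))`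
(disjoint-support independence) `≤ P_p(E ∩ A_b)·π_p(N)/(c π_p(b+1))` (one-arm quasi-multiplicativity).  Dividing by `π_p(N)`:

* `siteToBoundary_subset_tail`, `determinedBy_tail_sdiff` — the deterministic inclusion `A_N ⊆ T(b,N)` (lattice configurations;
  `A_N ⊆ A_b` is the lane's `RSW3.mem_siteToBoundary_of_le`) and the support of `T(b,N)`;
* `real_inter_siteToBoundary_le_of_oneArmQuasiMultAt` — **`c·π_p(b+1)·P_p(E ∩ A_N) ≤ P_p(E ∩ A_b)·π_p(N)`** (`b + 1 < N`);
* **`iicMeasure_real_le_div_of_oneArmQuasiMultAt`** — for every measure `ν` with Kesten's IIC limit property at `p` (`0 < p`, `d ≥ 1`,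
  `OneArmQuasiMultAt d p c`, `c > 0`) and every `E` determined by the pairs of `Λ(b)`:
  **`ν(E) ≤ P_p(E ∩ A_b) / (c·π_p(b+1)) ≤ P_p(E) / (c·π_p(b+1))`** — conditioning on the incipient infinite cluster inflates no event of
  `Λ(b)` by more than the inverse one-arm probability at scale `b+1`;
* **`iicMeasure_real_le_mul_cond_criticalProbI`** — at `p_c(ℤ^d)`, `d ≥ 2`, under (A2)□ at one aspect: ONE constant `C` with
  **`ν(E) ≤ C · P_{p_c}(E ∩ A_b)/π_{p_c}(b) = C · P_{p_c}(E | 0 ↔ ∂ⁱⁿΛ(b))`** for all `b ≥ 1` and all `E ∈ σ(Λ(b))` (the every-aspect window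
  bounds `π(b)/π(b+1)`); **`iicMeasure_real_le_mul_cond_Z2`** — the same on `ℤ²`, unconditionally.
Together with `real_le_iicMeasure_real_of_isUpperSet` (`P_p ≤ ν` on increasing cylinders) and `iicMeasure_real_le_real_of_isLowerSet`
(`ν ≤ P_p` on decreasing cylinders) this brackets the IIC measure on every box `σ`-field by explicit multiples of `P_p(· | A_b)`.

Helper file for the crux `stmt-CriticalPhenomena-4575` chain; no definitions, no sorries.
References: H. Kesten, PTRF 73 (1986) 369–394, §2 (eq. (2.17)–(2.22)); D. Basu, A. Sapozhnikov, ECP 22 (2017) no. 26, §2 (2.4)–(2.5);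
G. Grimmett, *Percolation* (1999), §2.2.
-/

noncomputable section

namespace Summit.CriticalPhenomena.PercolationContinuityZ3.Theorems.Crossing

open MeasureTheory ProbabilityTheory Filter Topology
open Literature.Probability.Percolation Literature.Probability.LatticeModels
open Literature.Probability.Percolation.DCT16
open Literature.Barriers.CriticalPhenomena
open Summit.CriticalPhenomena.PercolationContinuityZ3.Theorems.SurfaceTension
open scoped ENNReal ProbabilityTheory Literature.Probability.Percolation

variable {d : ℕ}

/-! ## Deterministic inclusions -/

/-- **`A_N ⊆ T(b,N)`** (`b + 1 < N`, lattice configurations): after its last visit to `Λ(b)` the arm to `∂ⁱⁿΛ(N)` is an open path inside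
`Λ(N) ∖ Λ(b)` from a site of `∂ⁱⁿΛ(b+1)` to `∂ⁱⁿΛ(N)`. [cite: Kesten1986, §2] -/
theorem siteToBoundary_subset_tail {b N : ℕ} (hbN : b + 1 < N) {ω : BondConfig (Site d)} (hω : ω ⊆ (zdGraph d).edgeSet)
    (h : ω ∈ siteToBoundary d N) :
    ω ∈ {ω : BondConfig (Site d) | ∃ s ∈ innerBoundary (zdGraph d) (box d (b + 1)),
      ∃ t ∈ innerBoundary (zdGraph d) (box d N), ω ∈ openConnIn ((↑(box d N) : Set (Site d)) \ ↑(box d b)) s t} := by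
  classical
  obtain ⟨t, ht, h0t⟩ := h
  obtain ⟨p, hpS, hpω⟩ := exists_walk_of_mem_openConnIn hω h0t
  have h0b : (0 : Site d) ∈ (↑(box d b) : Set (Site d)) := Finset.mem_coe.2 (zero_mem_box d b)
  have htb : t ∉ (↑(box d b) : Set (Site d)) := fun h' =>
    notMem_box_of_mem_innerBoundary_box (by omega : b < N) ht (Finset.mem_coe.1 h')
  obtain ⟨a₃, c₃, q₃, r₃, hac₃, ha₃, hc₃, hq₃B, hq₃p, -, hedges₃⟩ :=
    exists_cut_walk_edge ((↑(box d b) : Set (Site d))ᶜ) p.reverse htb (fun h => h h0b)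
  have hq₃ω : ∀ e ∈ q₃.edges, e ∈ ω := fun e he => by
    have h' : e ∈ p.reverse.edges := by rw [hedges₃]; exact List.mem_append_left _ he
    rw [SimpleGraph.Walk.edges_reverse, List.mem_reverse] at h'
    exact hpω e h'
  have hq₃n : ∀ z ∈ q₃.support, z ∈ (↑(box d N) : Set (Site d)) := fun z hz => by
    have h' := hq₃p z hz
    rw [SimpleGraph.Walk.support_reverse, List.mem_reverse] at h'
    exact hpS z h'
  have hc₃' : c₃ ∈ box d b := by
    by_contra h'
    exact hc₃ fun h'' => h' (Finset.mem_coe.1 h'')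
  have ha₃' : a₃ ∈ box d (b + 1) := mem_box_succ_of_adj_box hac₃.symm hc₃'
  have ha₃B : a₃ ∈ innerBoundary (zdGraph d) (box d (b + 1)) :=
    mem_innerBoundary_box_of_notMem_pred (by omega) ha₃' (by simpa using ha₃)
  refine ⟨a₃, ha₃B, t, ht, mem_openConnIn_of_walk q₃.reverse ?_ ?_⟩
  · intro u hu
    rw [SimpleGraph.Walk.support_reverse, List.mem_reverse] at hu
    exact ⟨hq₃n u hu, hq₃B u hu⟩
  · intro e he
    rw [SimpleGraph.Walk.edges_reverse, List.mem_reverse] at he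
    exact hq₃ω e he

/-- `T(b,N)` is determined by the pairs of `Λ(N) ∖ Λ(b)`. [folklore] -/
theorem determinedBy_tail_sdiff (b N : ℕ) :
    DeterminedBy {ω : BondConfig (Site d) | ∃ s ∈ innerBoundary (zdGraph d) (box d (b + 1)),
      ∃ t ∈ innerBoundary (zdGraph d) (box d N), ω ∈ openConnIn ((↑(box d N) : Set (Site d)) \ ↑(box d b)) s t}
      (((↑(box d N) : Set (Site d)) \ ↑(box d b)).sym2) := by
  have h : {ω : BondConfig (Site d) | ∃ s ∈ innerBoundary (zdGraph d) (box d (b + 1)),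
      ∃ t ∈ innerBoundary (zdGraph d) (box d N), ω ∈ openConnIn ((↑(box d N) : Set (Site d)) \ ↑(box d b)) s t} =
      ⋃ s ∈ innerBoundary (zdGraph d) (box d (b + 1)), ⋃ t ∈ innerBoundary (zdGraph d) (box d N),
        openConnIn ((↑(box d N) : Set (Site d)) \ ↑(box d b)) s t := by
    ext ω; simp only [Set.mem_setOf_eq, Set.mem_iUnion, exists_prop]
  rw [h]
  exact DeterminedBy.iUnion fun s => DeterminedBy.iUnion fun _ => DeterminedBy.iUnion fun t => DeterminedBy.iUnion fun _ =>
    determinedBy_openConnIn _ s t subset_rfl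

/-! ## The finite-volume domination inequality -/

/-- **`c·π_p(b+1)·P_p(E ∩ A_N) ≤ P_p(E ∩ A_b)·π_p(N)`** for `E` determined by the pairs of `Λ(b)`, `b + 1 < N`, under
`OneArmQuasiMultAt d p c` (`c ≥ 0`): `E ∩ A_N ⊆ (E ∩ A_b) ∩ T(b,N)` a.s., the two factors have disjoint supports, and
`c·π(b+1)·P(T(b,N)) ≤ c·π(b+1)·α(b+1,N) ≤ π(N)`. [cite: Kesten1986, §2 eq. (2.22)] [cite: BasuSapozhnikov2017ECP, §2 (2.5)] -/
theorem real_inter_siteToBoundary_le_of_oneArmQuasiMultAt (p : unitInterval) {c : ℝ} (hc : 0 ≤ c) (hQM : OneArmQuasiMultAt d p c)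
    {b N : ℕ} (hbN : b + 1 < N) {E : Set (BondConfig (Site d))} (hE : DeterminedBy E (↑((box d b).sym2) : Set (Sym2 (Site d)))) :
    c * oneArmProb d p (b + 1) * (bondPercolation (zdGraph d) p).real (E ∩ siteToBoundary d N) ≤
      (bondPercolation (zdGraph d) p).real (E ∩ siteToBoundary d b) * oneArmProb d p N := by
  classical
  set μ := bondPercolation (zdGraph d) p with hμ
  set T : Set (BondConfig (Site d)) := {ω : BondConfig (Site d) | ∃ s ∈ innerBoundary (zdGraph d) (box d (b + 1)),
    ∃ t ∈ innerBoundary (zdGraph d) (box d N), ω ∈ openConnIn ((↑(box d N) : Set (Site d)) \ ↑(box d b)) s t} with hT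
  -- `E ∩ A_N ⊆ (E ∩ A_b) ∩ T(b,N)` almost surely
  have h1 : μ.real (E ∩ siteToBoundary d N) ≤ μ.real ((E ∩ siteToBoundary d b) ∩ T) :=
    real_mono_of_forall_subset_edgeSet (zdGraph d) p fun ω hω h =>
      ⟨⟨h.1, RSW3.mem_siteToBoundary_of_le (by omega) hω h.2⟩, siteToBoundary_subset_tail hbN hω h.2⟩
  -- disjoint supports
  have hdetEA : DeterminedBy (E ∩ siteToBoundary d b) (↑((box d b).sym2) : Set (Sym2 (Site d))) :=
    hE.inter (DCT16.determinedBy_siteToBoundary d b)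
  have hdisj : Disjoint (↑((box d b).sym2) : Set (Sym2 (Site d))) (((↑(box d N) : Set (Site d)) \ ↑(box d b)).sym2) := by
    rw [Set.disjoint_left]
    intro e he heT
    induction e using Sym2.ind with
    | h u v =>
      rw [Finset.coe_sym2, Set.mk_mem_sym2_iff] at he
      rw [Set.mk_mem_sym2_iff] at heT
      exact heT.1.2 he.1
  have hind : μ.real ((E ∩ siteToBoundary d b) ∩ T) = μ.real (E ∩ siteToBoundary d b) * μ.real T :=
    bondPercolation_real_inter_of_disjoint (zdGraph d) p hdisj hdetEA (determinedBy_tail_sdiff b N)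
      hdetEA.measurableSet_of_finset (determinedBy_tail b N).measurableSet_of_finset
  -- `T(b,N)` is an annulus crossing from `Λ(b+1)`
  have hTle : μ.real T ≤ μ.real (boxCrossing d (b + 1) N) := by
    rw [← real_cross_eq_real_boxCrossing p (by omega : b + 1 ≤ N)]
    refine measureReal_mono (fun ω hω => ?_) (measure_ne_top _ _)
    obtain ⟨u, hu, t, ht, hut⟩ := hω
    exact ⟨u, (mem_innerBoundary_iff.1 hu).1, t, ht, openConnIn_mono (fun x hx => hx.1) _ _ hut⟩
  have hqm := hQM (b + 1) N (by omega) (by omega)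
  have hπ : 0 ≤ oneArmProb d p (b + 1) := measureReal_nonneg
  have hEA : 0 ≤ μ.real (E ∩ siteToBoundary d b) := measureReal_nonneg
  calc c * oneArmProb d p (b + 1) * μ.real (E ∩ siteToBoundary d N)
      ≤ c * oneArmProb d p (b + 1) * (μ.real (E ∩ siteToBoundary d b) * μ.real T) := by
        rw [← hind]; exact mul_le_mul_of_nonneg_left h1 (mul_nonneg hc hπ)
    _ = μ.real (E ∩ siteToBoundary d b) * (c * (oneArmProb d p (b + 1) * μ.real T)) := by ring
    _ ≤ μ.real (E ∩ siteToBoundary d b) * (c * (oneArmProb d p (b + 1) * μ.real (boxCrossing d (b + 1) N))) :=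
        mul_le_mul_of_nonneg_left (mul_le_mul_of_nonneg_left (mul_le_mul_of_nonneg_left hTle hπ) hc) hEA
    _ ≤ μ.real (E ∩ siteToBoundary d b) * oneArmProb d p N := mul_le_mul_of_nonneg_left hqm hEA

/-! ## The IIC measure on `σ(Λ(b))` -/

/-- **`ν(E) ≤ P_p(E ∩ A_b) / (c · π_p(b+1))`** for every measure `ν` with Kesten's IIC limit property at `p` (`0 < p`, `d ≥ 1`,
`OneArmQuasiMultAt d p c`, `c > 0`) and every event `E` determined by the pairs of `Λ(b)`: divide
`real_inter_siteToBoundary_le_of_oneArmQuasiMultAt` by `π_p(N)` and let `N → ∞`.  In particular `ν(E) ≤ P_p(E)/(c π_p(b+1))`: the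
Radon–Nikodym density of `ν` with respect to `P_p` on `σ(Λ(b))` is at most `(c π_p(b+1))⁻¹`.
[cite: Kesten1986, §2 eq. (2.22)] [cite: BasuSapozhnikov2017ECP, §2 (2.5)] -/
theorem iicMeasure_real_le_div_of_oneArmQuasiMultAt (hd : 1 ≤ d) (p : unitInterval) (hp : 0 < (p : ℝ)) {c : ℝ} (hc : 0 < c)
    (hQM : OneArmQuasiMultAt d p c) {ν : Measure (BondConfig (Site d))}
    (hν : ∀ (F : Finset (Sym2 (Site d))) (E : Set (BondConfig (Site d))), MeasurableSet E → DeterminedBy E ↑F →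
      Tendsto (fun n : ℕ => (bondPercolation (zdGraph d) p).real (E ∩ siteToBoundary d n) / oneArmProb d p n)
        atTop (𝓝 (ν.real E)))
    {b : ℕ} {E : Set (BondConfig (Site d))} (hE : DeterminedBy E (↑((box d b).sym2) : Set (Sym2 (Site d)))) :
    ν.real E ≤ (bondPercolation (zdGraph d) p).real (E ∩ siteToBoundary d b) / (c * oneArmProb d p (b + 1)) := by
  have hπ : ∀ m, 0 < oneArmProb d p m := oneArmProb_pos hd p hp
  refine le_of_tendsto (hν _ E hE.measurableSet_of_finset hE) ?_
  filter_upwards [eventually_gt_atTop (b + 1)] with N hN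
  rw [div_le_div_iff₀ (hπ N) (mul_pos hc (hπ (b + 1)))]
  calc (bondPercolation (zdGraph d) p).real (E ∩ siteToBoundary d N) * (c * oneArmProb d p (b + 1))
      = c * oneArmProb d p (b + 1) * (bondPercolation (zdGraph d) p).real (E ∩ siteToBoundary d N) := by ring
    _ ≤ _ := real_inter_siteToBoundary_le_of_oneArmQuasiMultAt p hc.le hQM hN hE

/-- **The IIC is dominated by the arm-conditioned measures, uniformly in the scale (ℤ^d, under (A2)□)**: at `p_c(ℤ^d)`, `d ≥ 2`, under
(A2)□ at aspect `(s,L)` (`2 ≤ s ≤ L`, `ϰ > 0`) there is `C > 0` such that for every measure `ν` with Kesten's IIC limit property, every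
`b ≥ 1` and every event `E` determined by the pairs of `Λ(b)`:
**`ν(E) ≤ C · P_{p_c}(E ∩ {0 ↔ ∂ⁱⁿΛ(b)}) / π_{p_c}(b)`**, i.e. `ν ≤ C · P_{p_c}(· | 0 ↔ ∂ⁱⁿΛ(b))` on `σ(Λ(b))`
(`π(b) ≤ π(b+1)/(c·w)` by quasi-multiplicativity and the every-aspect window at aspect `≤ 2`; `C = (c² w)⁻¹`, `w = (2d)⁻¹ 8^{1−d}`).
[cite: Kesten1986, §2 eq. (2.22)] [cite: BasuSapozhnikov2017ECP, Thm. 1.1 and §2 (2.5)] -/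
theorem iicMeasure_real_le_mul_cond_criticalProbI (hd : 2 ≤ d) {s L : ℕ} (hs : 2 ≤ s) (hsL : s ≤ L) {ϰ : ℝ} (hϰ : 0 < ϰ)
    (hA2 : SetToSetQuasiMultAspectAt d (criticalProbI d) s L ϰ) :
    ∃ C : ℝ, 0 < C ∧ ∀ (ν : Measure (BondConfig (Site d))),
      (∀ (F : Finset (Sym2 (Site d))) (E : Set (BondConfig (Site d))), MeasurableSet E → DeterminedBy E ↑F →
        Tendsto (fun n : ℕ => (bondPercolation (zdGraph d) (criticalProbI d)).real (E ∩ siteToBoundary d n) /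
          oneArmProb d (criticalProbI d) n) atTop (𝓝 (ν.real E))) →
      ∀ (b : ℕ), 1 ≤ b → ∀ (E : Set (BondConfig (Site d))), DeterminedBy E (↑((box d b).sym2) : Set (Sym2 (Site d))) →
        ν.real E ≤ C * ((bondPercolation (zdGraph d) (criticalProbI d)).real (E ∩ siteToBoundary d b) /
          oneArmProb d (criticalProbI d) b) := by
  obtain ⟨c, hc, hQM⟩ := oneArmQuasiMultAt_of_setToSetQuasiMultAspectAt hd hs hsL hϰ hA2
  have hpc : 0 < ((criticalProbI d : unitInterval) : ℝ) := by
    exact_mod_cast Literature.Barriers.CriticalPhenomena.criticalProbI_pos' (d := d) (by omega)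
  set w : ℝ := (2 * (d : ℝ))⁻¹ * ((1 : ℝ) / 8) ^ (d - 1) with hw
  have hw0 : 0 < w := by positivity
  have hπ : ∀ m, 0 < oneArmProb d (criticalProbI d) m := oneArmProb_pos (by omega) _ hpc
  refine ⟨1 / (c ^ 2 * w), by positivity, fun ν hν b hb E hE => ?_⟩
  set μ := bondPercolation (zdGraph d) (criticalProbI d) with hμ
  -- the window at aspect `≤ 2`: `w ≤ α(b, b+1)`
  have hwin := Rsw3.le_real_boxCrossing_criticalProbI_of_le (d := d) hd hb (by omega : b ≤ b + 1)
  have hα : w ≤ μ.real (boxCrossing d b (b + 1)) := by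
    refine le_trans ?_ hwin
    have hb1 : (1 : ℝ) ≤ b := by exact_mod_cast hb
    have hratio : (1 : ℝ) / 8 ≤ (b : ℝ) / (4 * ((b + 1 : ℕ) : ℝ)) := by
      rw [div_le_div_iff₀ (by norm_num) (by positivity)]
      push_cast
      linarith
    exact mul_le_mul_of_nonneg_left (pow_le_pow_left₀ (by norm_num) hratio _) (by positivity)
  -- quasi-multiplicativity: `c π(b) α(b,b+1) ≤ π(b+1)`, so `c w π(b) ≤ π(b+1)`
  have hqm := hQM b (b + 1) hb (by omega)
  have hcw : c * w * oneArmProb d (criticalProbI d) b ≤ oneArmProb d (criticalProbI d) (b + 1) := by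
    calc c * w * oneArmProb d (criticalProbI d) b = c * (oneArmProb d (criticalProbI d) b * w) := by ring
      _ ≤ c * (oneArmProb d (criticalProbI d) b * μ.real (boxCrossing d b (b + 1))) :=
          mul_le_mul_of_nonneg_left (mul_le_mul_of_nonneg_left hα (hπ b).le) hc.le
      _ ≤ oneArmProb d (criticalProbI d) (b + 1) := hqm
  have h := iicMeasure_real_le_div_of_oneArmQuasiMultAt (by omega) (criticalProbI d) hpc hc hQM hν (b := b) hE
  refine h.trans ?_
  have hP : 0 ≤ μ.real (E ∩ siteToBoundary d b) := measureReal_nonneg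
  rw [div_le_iff₀ (mul_pos hc (hπ (b + 1))), mul_div_assoc']
  rw [div_mul_eq_mul_div, le_div_iff₀ (hπ b)]
  calc μ.real (E ∩ siteToBoundary d b) * oneArmProb d (criticalProbI d) b
      = 1 / (c ^ 2 * w) * μ.real (E ∩ siteToBoundary d b) * (c * (c * w * oneArmProb d (criticalProbI d) b)) := by
        field_simp
    _ ≤ 1 / (c ^ 2 * w) * μ.real (E ∩ siteToBoundary d b) * (c * oneArmProb d (criticalProbI d) (b + 1)) :=
        mul_le_mul_of_nonneg_left (mul_le_mul_of_nonneg_left hcw hc.le) (mul_nonneg (by positivity) hP)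

/-- **The planar IIC is dominated by the arm-conditioned measures, uniformly in the scale — unconditionally**: there is `C > 0` such that
for every measure `ν` with Kesten's IIC limit property at `p_c(ℤ²) = 1/2`, every `b ≥ 1` and every `E ∈ σ(Λ(b))`:
**`ν(E) ≤ C · P_{1/2}(E | 0 ↔ ∂ⁱⁿΛ(b))`** ((A2)□(9,77) on `ℤ²` from RSW). [cite: Kesten1986, §2 eq. (2.22)] -/
theorem iicMeasure_real_le_mul_cond_Z2 :
    ∃ C : ℝ, 0 < C ∧ ∀ (ν : Measure (BondConfig (Site 2))),
      (∀ (F : Finset (Sym2 (Site 2))) (E : Set (BondConfig (Site 2))), MeasurableSet E → DeterminedBy E ↑F →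
        Tendsto (fun n : ℕ => (bondPercolation (zdGraph 2) (criticalProbI 2)).real (E ∩ siteToBoundary 2 n) /
          oneArmProb 2 (criticalProbI 2) n) atTop (𝓝 (ν.real E))) →
      ∀ (b : ℕ), 1 ≤ b → ∀ (E : Set (BondConfig (Site 2))), DeterminedBy E (↑((box 2 b).sym2) : Set (Sym2 (Site 2))) →
        ν.real E ≤ C * ((bondPercolation (zdGraph 2) (criticalProbI 2)).real (E ∩ siteToBoundary 2 b) /
          oneArmProb 2 (criticalProbI 2) b) := by
  obtain ⟨ϰ, hϰ, hA2⟩ := exists_setToSetQuasiMultAspectAt_two_of_criticalProbI_le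
  exact iicMeasure_real_le_mul_cond_criticalProbI (d := 2) le_rfl (s := 9) (L := 77) (by norm_num) (by norm_num) hϰ (hA2 _ le_rfl)

end Summit.CriticalPhenomena.PercolationContinuityZ3.Theorems.Crossing

end
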